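import Mathlib
import HarnessLib
import Summits.ResolutionOfSingularities.ResolutionOfSingularities.Theorems.WildQuotientsWildQuotientResolutionConductorOnePresentationMap
import Summits.ResolutionOfSingularities.ResolutionOfSingularities.Theorems.WildQuotientsWildQuotientResolutionConductorOneChartAlgebraSCE
import Summits.ResolutionOfSingularities.ResolutionOfSingularities.Theorems.WildQuotientsWildQuotientResolutionConductorOneOneVariablePoly

/-!
# S2 F5b (part 2b): the chart action on polynomials, the norm element `N'`, the twisted evaluation
(crux stmt-ResolutionOfSingularities-15640 `WildQuotients.WildQuotientResolution`, line `Sketch`;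
chain w45c post-V5 programme S2, design `L/res-L1-w45c-lead-1/S2-DESIGN.md` v1.1 §7 (7.1)/(7.4)/(7.7),
res-L1-w45c-plan-1 RULINGs 2026-08-27T17:07:17Z (R1)/(R4), 17:08:39Z (norm factorisation of `h_M`).
[OURS · L1 W4.5c] — NOT a statement of the manuscript. Lead prover res-L1-w45c-lead-1.)

For the straightened chart ring `M = ChartRing k p n i I` (`i ∈ I`) and a `k`-algebra endomorphism
`σ` with the diagonal-Möbius laws (`IsChartAction`):
* `chartDen_ne_zero`, `chart_algebraMap_injective`, `chartRing_isDomain` (the unit facts for `u`,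
  `1 + s` are res-D-pv-033's `…ConductorOneFrameChartMap`);
* `sigma_algebraMap` — `σ` on the image of a polynomial is the twisted evaluation
  `x_l ↦ x_l·w` (`l ∈ I`), `x_l ↦ x_l·(1+s)` (`l ∉ I`), `w = (1+s)⁻¹`; `sigma_algebraMap_monomial` —
  `σ(x^m) = x^m · w^{A(m)} (1+s)^{B(m)}`, `A(m) = ∑_{l∈I} m_l`, `B(m) = ∑_{l∉I} m_l`;
* `chartNu` — the norm element `N' = ∏_{l∈I∖i} ν_l ∏_{l∉I} ν_l` (stub-3's `nu_K_eq`/`nu_J_eq`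
  closed forms), `algebraMap_chartDen_eq` (`h_M = u^{1+|I∖i|} · N'` in `M`), `sigma_chartNu`
  (`σ N' = N'`), `isUnit_chartNu`, and `exists_mul_chartNu_pow_eq` (every `x ∈ M` has
  `x · N'^r = b(x) · v^t` with `b ∈ k[x]`, `v = u⁻¹`);
* `twist_aeval`, `twistSubst_add_level` — the one-variable identities
  `(1+s)^D · P(s w) = (Φ_D P)(s)` and `Φ_{D+e} P = (1+X)^e Φ_D P` in any `k`-algebra.
-/

-- single-problem summit: the doubled namespace component `ResolutionOfSingularities` is forced
set_option linter.dupNamespace false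

noncomputable section

open MvPolynomial

namespace Summit.ResolutionOfSingularities.ResolutionOfSingularities.Theorems.WildQuotientResolution.ConductorOne

/-! ## One-variable identities in an arbitrary algebra -/

section OneVar

variable {k : Type} [CommRing k] {R : Type} [CommRing R] [Algebra k R]

/-- **Twisted evaluation**: `(1+s)^D · P(s·w) = (Φ_D P)(s)` for `(1+s)·w = 1`, `natDegree P ≤ D`.
[OURS · L1 W4.5c] -/
theorem twist_aeval (s w : R) (hw : (1 + s) * w = 1) (P : Polynomial k) (D : ℕ)
    (hP : P.natDegree ≤ D) :
    (1 + s) ^ D * Polynomial.aeval (s * w) P = Polynomial.aeval s (twistSubst D P) := by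
  conv_lhs => rw [P.as_sum_range' (D + 1) (Nat.lt_succ_of_le hP)]
  rw [map_sum, Finset.mul_sum, twistSubst, map_sum]
  refine Finset.sum_congr rfl fun a ha => ?_
  have ha' : a ≤ D := Nat.lt_succ_iff.mp (Finset.mem_range.mp ha)
  rw [Polynomial.aeval_monomial, map_mul, map_mul, map_pow, map_pow, map_add, map_one,
    Polynomial.aeval_C, Polynomial.aeval_X]
  have hpow : (1 + s) ^ D * (s * w) ^ a = s ^ a * (1 + s) ^ (D - a) := by
    have hD : D = (D - a) + a := by omega
    rw [mul_pow, hD, pow_add, Nat.add_sub_cancel]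
    have : (1 + s) ^ a * w ^ a = 1 := by rw [← mul_pow, hw, one_pow]
    calc (1 + s) ^ (D - a) * (1 + s) ^ a * (s ^ a * w ^ a)
        = (1 + s) ^ (D - a) * s ^ a * ((1 + s) ^ a * w ^ a) := by ring
      _ = s ^ a * (1 + s) ^ (D - a) := by rw [this]; ring
  calc (1 + s) ^ D * (algebraMap k R (P.coeff a) * (s * w) ^ a)
      = algebraMap k R (P.coeff a) * ((1 + s) ^ D * (s * w) ^ a) := by ring
    _ = algebraMap k R (P.coeff a) * s ^ a * (1 + s) ^ (D - a) := by rw [hpow]; ring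

/-- Raising the level of `Φ`: `Φ_{D+e} P = (1+X)^e · Φ_D P` for `natDegree P ≤ D`. [OURS · L1 W4.5c] -/
theorem twistSubst_add_level (P : Polynomial k) (D e : ℕ) (hP : P.natDegree ≤ D) :
    twistSubst (D + e) P = (1 + Polynomial.X) ^ e * twistSubst D P := by
  rw [twistSubst, twistSubst, Finset.mul_sum]
  have hsub : Finset.range (D + 1) ⊆ Finset.range (D + e + 1) :=
    Finset.range_subset_range.mpr (by omega)
  have hzero : ∀ a ∈ Finset.range (D + e + 1), a ∉ Finset.range (D + 1) →
      Polynomial.C (P.coeff a) * Polynomial.X ^ a * (1 + Polynomial.X) ^ (D + e - a) = 0 := by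
    intro a ha hna
    have ha' : D < a := by simp only [Finset.mem_range, not_lt] at ha hna; omega
    rw [Polynomial.coeff_eq_zero_of_natDegree_lt (lt_of_le_of_lt hP ha'), map_zero, zero_mul,
      zero_mul]
  rw [← Finset.sum_subset hsub hzero]
  refine Finset.sum_congr rfl fun a ha => ?_
  have ha' : a ≤ D := Nat.lt_succ_iff.mp (Finset.mem_range.mp ha)
  rw [show D + e - a = e + (D - a) by omega, pow_add]
  ring

end OneVar

/-! ## The chart ring: injectivity, units, the action on polynomials -/

section Chart

variable (k : Type) [Field k] (p n : ℕ) (i : Fin n) (I : Finset (Fin n))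

/-- `h_M ≠ 0` (its value at the origin is `1`). [OURS · L1 W4.5c] -/
theorem chartDen_ne_zero [Fact p.Prime] : chartDen k p n i I ≠ 0 := by
  intro h
  have hp : p - 1 ≠ 0 := by have := (Fact.out : p.Prime).two_le; omega
  have h1 := congrArg (MvPolynomial.eval (fun _ : Fin n => (0 : k))) h
  have hval : MvPolynomial.eval (fun _ : Fin n => (0 : k)) (chartDen k p n i I) = 1 := by
    unfold chartDen
    simp only [map_mul, map_sub, map_one, map_pow, map_add, map_prod, MvPolynomial.eval_X,
      zero_pow hp, sub_zero, mul_zero, add_zero, one_pow, mul_one, Finset.prod_const_one]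
  rw [hval, map_zero] at h1
  exact one_ne_zero h1

/-- `k[x] → M` is injective. [OURS · L1 W4.5c] -/
theorem chart_algebraMap_injective [Fact p.Prime] :
    Function.Injective (algebraMap (MvPolynomial (Fin n) k) (ChartRing k p n i I)) :=
  IsLocalization.injective (ChartRing k p n i I)
    (powers_le_nonZeroDivisors_of_noZeroDivisors (chartDen_ne_zero k p n i I))

/-- `M` is a domain. [OURS · L1 W4.5c] -/
theorem chartRing_isDomain [Fact p.Prime] : IsDomain (ChartRing k p n i I) :=
  IsLocalization.isDomain_localization
    (powers_le_nonZeroDivisors_of_noZeroDivisors (chartDen_ne_zero k p n i I))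

/-- `M` has characteristic `p`. [OURS · L1 W4.5c] -/
theorem chartRing_charP [Fact p.Prime] [CharP k p] : CharP (ChartRing k p n i I) p := by
  haveI := chartRing_isDomain k p n i I
  exact charP_of_injective_algebraMap (algebraMap k (ChartRing k p n i I)).injective p

/-- The inverse `w` of `1 + s`. [OURS · L1 W4.5c] -/
def chartW [Fact p.Prime] [CharP k p] : ChartRing k p n i I := ↑((isUnit_one_add_chartX_self k p n i I).unit⁻¹)

/-- `(1 + s) · w = 1`. [OURS · L1 W4.5c] -/
theorem one_add_chartS_mul_chartW [Fact p.Prime] [CharP k p] : (1 + chartX k p n i I i) * chartW k p n i I = 1 :=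
  (isUnit_one_add_chartX_self k p n i I).mul_val_inv

/-- The inverse `v` of `u`. [OURS · L1 W4.5c] -/
def chartV : ChartRing k p n i I := ↑((chartUUnit k p n i I)⁻¹)

/-- `u · v = 1`. [OURS · L1 W4.5c] -/
theorem chartU_mul_chartV : (1 - chartX k p n i I i ^ (p - 1)) * chartV k p n i I = 1 :=
  (isUnit_one_sub_chartX_pow k p n i I).mul_val_inv

/-- `↑(U⁻¹) = v`. [OURS · L1 W4.5c] -/
theorem val_chartUUnit_inv : ((chartUUnit k p n i I)⁻¹ : (ChartRing k p n i I)ˣ).val = chartV k p n i I :=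
  rfl

/-- The image of a polynomial is its evaluation at the chart coordinates. [OURS · L1 W4.5c] -/
theorem chart_algebraMap_eq_aeval (b : MvPolynomial (Fin n) k) :
    algebraMap (MvPolynomial (Fin n) k) (ChartRing k p n i I) b = aeval (chartX k p n i I) b := by
  have h := MvPolynomial.aeval_unique (IsScalarTower.toAlgHom k (MvPolynomial (Fin n) k)
    (ChartRing k p n i I))
  have h2 := DFunLike.congr_fun h b
  rw [IsScalarTower.toAlgHom_apply] at h2
  exact h2

variable (σ : ChartRing k p n i I →ₐ[k] ChartRing k p n i I)
  (hσ : IsChartAction k p n i I (σ : ChartRing k p n i I →+* ChartRing k p n i I))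

/-- The twisted values `θ_l`: `x_l·w` for `l ∈ I`, `x_l·(1+s)` for `l ∉ I`. [OURS · L1 W4.5c] -/
def chartTheta [Fact p.Prime] [CharP k p] (l : Fin n) : ChartRing k p n i I :=
  if l ∈ I then chartX k p n i I l * chartW k p n i I else chartX k p n i I l * (1 + chartX k p n i I i)

include hσ in
/-- `σ x_l = θ_l`. [OURS · L1 W4.5c] -/
theorem sigma_chartX [Fact p.Prime] [CharP k p] (l : Fin n) : σ (chartX k p n i I l) = chartTheta k p n i I l := by
  obtain ⟨_, hK, hJ⟩ := hσ
  unfold chartTheta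
  by_cases hl : l ∈ I
  · rw [if_pos hl]
    have h := hK l hl
    change σ (chartX k p n i I l) * (1 + chartX k p n i I i) = chartX k p n i I l at h
    calc σ (chartX k p n i I l)
        = σ (chartX k p n i I l) * ((1 + chartX k p n i I i) * chartW k p n i I) := by
          rw [one_add_chartS_mul_chartW, mul_one]
      _ = chartX k p n i I l * chartW k p n i I := by rw [← mul_assoc, h]
  · rw [if_neg hl]
    exact hJ l hl

include hσ in
/-- **`σ` on polynomials** is the twisted evaluation. [OURS · L1 W4.5c] -/
theorem sigma_algebraMap [Fact p.Prime] [CharP k p] (b : MvPolynomial (Fin n) k) :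
    σ (algebraMap (MvPolynomial (Fin n) k) (ChartRing k p n i I) b) = aeval (chartTheta k p n i I) b := by
  rw [chart_algebraMap_eq_aeval, ← AlgHom.comp_apply, MvPolynomial.comp_aeval]
  congr 2
  funext l
  exact sigma_chartX k p n i I σ hσ l

/-- `A(m) = ∑_{l∈I} m_l`. [OURS · L1 W4.5c] -/
def degA (m : Fin n →₀ ℕ) : ℕ := ∑ l ∈ I, m l

/-- `B(m) = ∑_{l∉I} m_l`. [OURS · L1 W4.5c] -/
def degB (m : Fin n →₀ ℕ) : ℕ := ∑ l ∈ Finset.univ \ I, m l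

include hσ in
/-- **`σ` on a monomial**: `σ(c x^m) = c x^m · w^{A(m)} · (1+s)^{B(m)}`. [OURS · L1 W4.5c] -/
theorem sigma_algebraMap_monomial [Fact p.Prime] [CharP k p] (m : Fin n →₀ ℕ) (c : k) :
    σ (algebraMap (MvPolynomial (Fin n) k) (ChartRing k p n i I) (monomial m c)) =
      algebraMap (MvPolynomial (Fin n) k) (ChartRing k p n i I) (monomial m c) *
        chartW k p n i I ^ degA n I m * (1 + chartX k p n i I i) ^ degB n I m := by
  classical
  rw [sigma_algebraMap k p n i I σ hσ, chart_algebraMap_eq_aeval, aeval_monomial, aeval_monomial,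
    Finsupp.prod_fintype _ _ (fun l => by simp), Finsupp.prod_fintype _ _ (fun l => by simp)]
  -- split the twisted factors
  have hθ : ∀ l, chartTheta k p n i I l ^ m l = chartX k p n i I l ^ m l *
      (if l ∈ I then chartW k p n i I else (1 + chartX k p n i I i)) ^ m l := by
    intro l
    unfold chartTheta
    split_ifs <;> rw [mul_pow]
  simp_rw [hθ]
  rw [Finset.prod_mul_distrib]
  have hsplit := Finset.prod_filter_mul_prod_filter_not Finset.univ (fun l => l ∈ I)
    (fun l => (if l ∈ I then chartW k p n i I else (1 + chartX k p n i I i)) ^ m l)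
  have hI : Finset.univ.filter (fun l => l ∈ I) = I := by ext l; simp
  have hIc : Finset.univ.filter (fun l => ¬ l ∈ I) = Finset.univ \ I := by ext l; simp
  rw [hI, hIc] at hsplit
  have h1 : ∏ l ∈ I, (if l ∈ I then chartW k p n i I else (1 + chartX k p n i I i)) ^ m l =
      chartW k p n i I ^ degA n I m := by
    rw [degA, ← Finset.prod_pow_eq_pow_sum]
    exact Finset.prod_congr rfl fun l hl => by rw [if_pos hl]
  have h2 : ∏ l ∈ Finset.univ \ I, (if l ∈ I then chartW k p n i I else (1 + chartX k p n i I i)) ^ m l =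
      (1 + chartX k p n i I i) ^ degB n I m := by
    rw [degB, ← Finset.prod_pow_eq_pow_sum]
    exact Finset.prod_congr rfl fun l hl => by rw [if_neg (Finset.mem_sdiff.mp hl).2]
  rw [← hsplit, h1, h2]
  ring

include hσ in
/-- `σ s · (1 + s) = s` (the `s`-law, restated for the `AlgHom`). [OURS · L1 W4.5c] -/
theorem sigma_s_law : σ (chartX k p n i I i) * (1 + chartX k p n i I i) = chartX k p n i I i :=
  hσ.1

include hσ in
/-- `σ v = v (1+s)^p`. [OURS · L1 W4.5c] -/
theorem sigma_chartV [Fact p.Prime] [CharP k p] : σ (chartV k p n i I) = chartV k p n i I * (1 + chartX k p n i I i) ^ p := by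
  haveI := chartRing_charP k p n i I
  exact v_negdeg (σ : ChartRing k p n i I →+* ChartRing k p n i I) (chartX k p n i I i)
    (sigma_s_law k p n i I σ hσ) p (chartV k p n i I) (chartU_mul_chartV k p n i I)

/-! ### The norm element `N'` -/

/-- `ν_l` for `l ∈ I ∖ i`: `1 − s^{p−1} c_l v + c_l^p v`. [OURS · L1 W4.5c] -/
def nuK (l : Fin n) : ChartRing k p n i I :=
  1 - chartX k p n i I i ^ (p - 1) * chartX k p n i I l * chartV k p n i I +
    chartX k p n i I l ^ p * chartV k p n i I

/-- `ν_l` for `l ∉ I`: `1 − (s e_l)^{p−1} + e_l^p u`. [OURS · L1 W4.5c] -/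
def nuJ (l : Fin n) : ChartRing k p n i I :=
  1 - (chartX k p n i I i * chartX k p n i I l) ^ (p - 1) +
    chartX k p n i I l ^ p * (1 - chartX k p n i I i ^ (p - 1))

/-- **The norm element** `N' = ∏_{l ∈ I∖i} ν_l · ∏_{l ∉ I} ν_l`. [OURS · L1 W4.5c] -/
def chartNu : ChartRing k p n i I :=
  (∏ l ∈ I.erase i, nuK k p n i I l) * ∏ l ∈ Finset.univ \ I, nuJ k p n i I l

/-- **`h_M = u^{1+|I∖i|} · N'` in `M`** (stub-3's `nu_K_eq`, `nu_J_eq`). [OURS · L1 W4.5c] -/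
theorem algebraMap_chartDen_eq [Fact p.Prime] [CharP k p] :
    algebraMap (MvPolynomial (Fin n) k) (ChartRing k p n i I) (chartDen k p n i I) =
      (1 - chartX k p n i I i ^ (p - 1)) ^ (1 + (I.erase i).card) * chartNu k p n i I := by
  haveI := chartRing_charP k p n i I
  have hK : ∀ l, algebraMap (MvPolynomial (Fin n) k) (ChartRing k p n i I)
      ((1 + X l) * ((1 + X l) ^ (p - 1) - X i ^ (p - 1))) =
        nuK k p n i I l * (1 - chartX k p n i I i ^ (p - 1)) := by
    intro l
    simp only [map_mul, map_sub, map_add, map_one, map_pow]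
    exact (nu_K_eq (chartX k p n i I i) (chartX k p n i I) p (chartV k p n i I)
      (chartU_mul_chartV k p n i I) l).symm
  have hJ : ∀ l, algebraMap (MvPolynomial (Fin n) k) (ChartRing k p n i I)
      ((1 + X l) * ((1 + X l) ^ (p - 1) - (X i * X l) ^ (p - 1))) = nuJ k p n i I l := by
    intro l
    simp only [map_mul, map_sub, map_add, map_one, map_pow]
    exact (nu_J_eq (chartX k p n i I i) (chartX k p n i I) p l).symm
  have hden : algebraMap (MvPolynomial (Fin n) k) (ChartRing k p n i I) (chartDen k p n i I) =
      algebraMap (MvPolynomial (Fin n) k) (ChartRing k p n i I) ((1 - X i ^ (p - 1)) *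
        ((∏ l ∈ I.erase i, ((1 + X l) * ((1 + X l) ^ (p - 1) - X i ^ (p - 1)))) *
          ∏ l ∈ Finset.univ \ I, ((1 + X l) * ((1 + X l) ^ (p - 1) - (X i * X l) ^ (p - 1))))) :=
    rfl
  rw [hden, map_mul, map_mul, map_prod, map_prod, map_sub, map_one, map_pow]
  simp_rw [hK, hJ]
  rw [Finset.prod_mul_distrib, Finset.prod_const, chartNu]
  ring

include hσ in
/-- `σ N' = N'`. [OURS · L1 W4.5c] -/
theorem sigma_chartNu [Fact p.Prime] [CharP k p] : σ (chartNu k p n i I) = chartNu k p n i I := by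
  haveI := chartRing_charP k p n i I
  obtain ⟨hs, hKlaw, hJlaw⟩ := hσ
  have hKlaw' : ∀ l, σ (chartX k p n i I l) * (1 + chartX k p n i I i) = chartX k p n i I l ∨ l ∉ I :=
    fun l => by by_cases hl : l ∈ I <;> [left; right] <;> [exact hKlaw l hl; exact hl]
  rw [chartNu, map_mul, map_prod, map_prod]
  congr 1
  · refine Finset.prod_congr rfl fun l hl => ?_
    have hlI : l ∈ I := Finset.mem_of_mem_erase hl
    -- `nu_K_invariant'` with `κ := I` (as a subtype family) — apply with the law at `l`
    exact nu_K_invariant' (σ : ChartRing k p n i I →+* ChartRing k p n i I) (chartX k p n i I i) hs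
      (fun l' : I => chartX k p n i I l') (fun l' => hKlaw l' l'.2) p (chartW k p n i I)
      (one_add_chartS_mul_chartW k p n i I) (chartV k p n i I) (chartU_mul_chartV k p n i I) ⟨l, hlI⟩
  · refine Finset.prod_congr rfl fun l hl => ?_
    have hlI : l ∉ I := (Finset.mem_sdiff.mp hl).2
    exact nu_J_invariant' (σ : ChartRing k p n i I →+* ChartRing k p n i I) (chartX k p n i I i) hs
      (fun l' : {l // l ∉ I} => chartX k p n i I l') (fun l' => hJlaw l' l'.2) p ⟨l, hlI⟩

/-- `N'` is a unit. [OURS · L1 W4.5c] -/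
theorem isUnit_chartNu [Fact p.Prime] [CharP k p] : IsUnit (chartNu k p n i I) := by
  have h := isUnit_algebraMap_chartDen k p n i I
  rw [algebraMap_chartDen_eq] at h
  exact isUnit_of_mul_isUnit_right h

/-- **Every element of `M` becomes polynomial times a power of `v` after multiplying by a power of
`N'`**: `x · N'^r = b · v^{(1+|I∖i|) r}`. [OURS · L1 W4.5c] -/
theorem exists_mul_chartNu_pow_eq [Fact p.Prime] [CharP k p] (x : ChartRing k p n i I) :
    ∃ (b : MvPolynomial (Fin n) k) (r : ℕ), x * chartNu k p n i I ^ r =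
      algebraMap (MvPolynomial (Fin n) k) (ChartRing k p n i I) b *
        chartV k p n i I ^ ((1 + (I.erase i).card) * r) := by
  obtain ⟨⟨b, ⟨_, ⟨r, rfl⟩⟩⟩, hb⟩ := IsLocalization.surj (Submonoid.powers (chartDen k p n i I)) x
  simp only at hb
  refine ⟨b, r, ?_⟩
  rw [map_pow, algebraMap_chartDen_eq, mul_pow, ← pow_mul] at hb
  -- `x * (u^t * N'^r) = b` ⇒ `x * N'^r = b * v^t`
  have huv : (1 - chartX k p n i I i ^ (p - 1)) ^ ((1 + (I.erase i).card) * r) *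
      chartV k p n i I ^ ((1 + (I.erase i).card) * r) = 1 := by
    rw [← mul_pow, chartU_mul_chartV, one_pow]
  calc x * chartNu k p n i I ^ r
      = x * chartNu k p n i I ^ r * ((1 - chartX k p n i I i ^ (p - 1)) ^ ((1 + (I.erase i).card) * r) *
          chartV k p n i I ^ ((1 + (I.erase i).card) * r)) := by rw [huv, mul_one]
    _ = x * ((1 - chartX k p n i I i ^ (p - 1)) ^ ((1 + (I.erase i).card) * r) *
          chartNu k p n i I ^ r) * chartV k p n i I ^ ((1 + (I.erase i).card) * r) := by ring
    _ = _ := by rw [hb]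

end Chart

end Summit.ResolutionOfSingularities.ResolutionOfSingularities.Theorems.WildQuotientResolution.ConductorOne

end
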